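import Literature.Geometry.Kaehler.CurveHolomorphicOneForms
import Literature.AlgebraicGeometry.HodgeTheory.HypersurfaceGeometricGenusProofs
import Literature.AlgebraicGeometry.HodgeTheory.ComplexGysinHodgeType
import Literature.AlgebraicGeometry.HodgeTheory.ComplexConjugationHolds
import Literature.AlgebraicGeometry.HodgeTheory.HodgeModelConnected
import Literature.AlgebraicGeometry.HodgeTheory.ComplexBettiKunneth
import Literature.AlgebraicGeometry.HodgeTheory.WeilClassesCyclicPrymDimension
import Literature.AlgebraicGeometry.HodgeTheory.FermatHypersurfaceReduction
import Literature.AlgebraicGeometry.Motives.MotivatedPeriodTorsor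
import HarnessLib

/-!
# `b₁ ≤ 2` for smooth plane cubics, and `dim H²(C₃ × C₃) ≤ 6` for the Fermat cubic curve

Family `hodge`, layer `Literature/AlgebraicGeometry/HodgeTheory`. PROOF FILE (theorems only; no
definitions, no named facts — D-0026) supplying, on the tree's real carriers
(`complexBetti X k = Hᵏ(X(ℂ); ℂ)`), the first of the two classical Betti-number inputs of the
conditional refutation `not_fermatHodgeClassesLiftToCurvePowers_of_finrank`
(`FermatHodgeClassesLiftToCurveAndJacobianPowers`): the bound `dim_ℂ H²((C₃ × C₃)(ℂ); ℂ) ≤ 6` for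
the Fermat cubic curve `C₃ = fermatHypersurface 1 3` (in fact `= 6`: `C₃` is an elliptic curve).

In print: a nonsingular plane cubic has genus `g = (d-1)(d-2)/2 = 1` (Hartshorne, *Algebraic
Geometry*, I Ex. 7.2 (b) / IV Example 1.3.? ; analytically: `ω_Y ≅ 𝒪_Y(d-3) = 𝒪_Y`, II Example
8.20.3, so the Poincaré residue `Res(Ω/F)` is a NOWHERE-VANISHING holomorphic `1`-form, and every
holomorphic `1`-form is a constant multiple of it — Farkas–Kra, *Riemann Surfaces*, I.1.5 and
II.5.3), whence `h^{1,0} = h^{0,1} = 1` and `b₁ = 2` (Hodge decomposition), and Künneth gives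
`b₂(C₃ × C₃) = b₂ b₀ + b₁ b₁ + b₀ b₂ = 1 + 4 + 1 = 6` (Hatcher, Thm. 3.16). Here, with the tree's
PROVED ingredients — Griffiths' residue form on a Hodge model of a smooth hypersurface
(`residueForm`, `isHolomorphicInCharts_residueForm`, `residueForm_ne_zero`: for `d = m + 2` the
residue form `Res(X_{i₀}^{d-m-2} Ω/F) = Res(Ω/F)` is non-zero at EVERY point of the `i₀`-th chart,
i.e. nowhere zero), the curve lemma `finrank_hodgePQ_one_one_zero_le_one` /
`finrank_hodgePQ_one_zero_one_le_one` (`Geometry/Kaehler/CurveHolomorphicOneForms`), the Hodge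
decomposition of a Hodge model (`HodgeModel.exists_sum_eq_of_hodgeDecomposition`) and the Betti
numbers of products (`finrank_complexBetti_tensor`):

* `finrank_hodgePQ_le_one_of_isSmoothHypersurface_one_three` — for a smooth plane cubic `Y` and
  any Hodge model `A`, `dim K^{1,0}(Y^an) ≤ 1` and `dim K^{0,1}(Y^an) ≤ 1`;
* `finrank_complexBetti_one_le_two_of_isSmoothHypersurface_one_three` — **`b₁(Y) ≤ 2`**;
* `finrank_complexBetti_one_fermatCubicCurve_le_two` — the Fermat cubic curve `x₀³ + x₁³ + x₂³ = 0`;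
* `finrank_complexBetti_two_pow_two_fermatCubicCurve_le`,
  `finite_complexBetti_two_pow_two_fermatCubicCurve` — **`dim H²((C₃.pow 2)(ℂ); ℂ) ≤ 6`** on the
  carrier `(fermatHypersurface 1 3).pow 2 = (Spec ℂ ⊗ C₃) ⊗ C₃` of the refutation, and its
  finite-dimensionality (hypothesis `h₆` and the instance of
  `not_fermatHodgeClassesLiftToCurvePowers_of_finrank`).

The reverse inequalities (`b₁ = 2`: `p_g ≥ 1`, `Hartshorne1977_hypersurface_geometricGenus_pos_holds`)
are not needed by the consumer and are not recorded.

## References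

* [Hartshorne1977] R. Hartshorne, Algebraic Geometry (1977), II Example 8.20.3 (`ω_Y ≅ 𝒪_Y(d-n-1)`),
  I Ex. 7.2.
* [FarkasKra1992] H. M. Farkas, I. Kra, Riemann Surfaces (1992), I.1.5, II.5.3.
* [VoisinHodgeII2003] C. Voisin, Hodge Theory and Complex Algebraic Geometry II (2003), §6.1.3
  (Griffiths residues), and vol. I §6.1.3 (Hodge decomposition).
* [HatcherAT2002] A. Hatcher, Algebraic Topology (2002), §3.2 Thm. 3.16 (Künneth).
-/

noncomputable section

open scoped Manifold ContDiff Topology LinearAlgebra.Projectivization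
open CategoryTheory AlgebraicGeometry MonoidalCategory
open Literature.AlgebraicGeometry.Motives Literature.AlgebraicTopology.SingularHomology
open Literature.NumberTheory.Transcendental Literature.Geometry.Kaehler

namespace Literature.AlgebraicGeometry.HodgeTheory

/-! ### Smooth plane cubics: `h^{1,0} ≤ 1`, `h^{0,1} ≤ 1`, `b₁ ≤ 2` -/

section PlaneCubic

variable {Y : Motives.SchemeOver ℂ}

/-- **`dim K^{1,0} ≤ 1` and `dim K^{0,1} ≤ 1` for a smooth plane cubic**, on every Hodge model `A`
of `Y` (`IsSmoothHypersurface 1 3 Y`): the residue form `Res(Ω/F)` of the cubic equation `F` is a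
holomorphic `1`-form on `Y^an` vanishing nowhere (`residueForm_ne_zero` at every point, the
polynomial weight `X_{i₀}^{d-m-2}` being `1` for `d = 3`, `m = 1`), so the curve lemma
`finrank_hodgePQ_one_one_zero_le_one` / `…one_zero_one_le_one` applies on the compact connected
curve `Y^an`. [cite: Hartshorne1977, II Example 8.20.3] [cite: FarkasKra1992, I.1.5 and II.5.3]
[cite: VoisinHodgeII2003, §6.1.3] -/
theorem finrank_hodgePQ_le_one_of_isSmoothHypersurface_one_three
    (hY : Motives.IsSmoothHypersurface 1 3 Y) (A : HodgeModel 1 Y) :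
    Module.finrank ℂ ↥(hodgePQ A.model A.carrier 1 1 0) ≤ 1 ∧
      Module.finrank ℂ ↥(hodgePQ A.model A.carrier 1 0 1) ≤ 1 := by
  obtain ⟨F, hF, hirr, hcut⟩ := hY.2
  have hjac := Hartshorne1977_smoothHypersurface_jacobian_holds 1 3 Y F hY.1 hF hirr hcut
  obtain ⟨_, ι, hι, hrange⟩ := hcut
  obtain ⟨hemb, hrangeψ, hcoord⟩ := hypersurface_complexPoints ι hF hrange
  haveI : CompactSpace A.carrier := A.compactSpace_carrier hY.1
  haveI : ConnectedSpace A.carrier := A.connectedSpace_carrier hY.1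
  set ψ : A.carrier → ℙ ℂ (Fin (1 + 2) → ℂ) := hypersurfacePoint ι ∘ A.toComplexPoints with hψ
  have hψemb : Topology.IsEmbedding ψ :=
    hemb.comp A.isAnalytification.homeomorph.isEmbedding
  have hψrange : Set.range ψ = Projectivization.projZeroLocus {F} := by
    rw [hψ, Set.range_comp, A.isAnalytification.isHomeomorph.surjective.range_eq, Set.image_univ,
      hrangeψ]
  -- the affine coordinates of `ψ` are holomorphic (regular functions pull back to holomorphic ones)
  have hhol : HasHolomorphicCoords A.model ψ := by
    intro i j
    obtain ⟨U, hU, hs⟩ := hcoord i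
    obtain ⟨s, hs⟩ := hs j
    have hhol := A.isAnalytification.mdifferentiableOn_evalOrZero U s
    have hset : ψ ⁻¹' (Projectivization.stdChart i).source =
        A.toComplexPoints ⁻¹' {P | P.pt ∈ (↑U : Y.left.Opens)} := by
      rw [hU, hψ, Set.preimage_comp]
    change MDifferentiableOn 𝓘(ℂ, A.model) 𝓘(ℂ, ℂ) _ (ψ ⁻¹' (Projectivization.stdChart i).source)
    rw [hset]
    exact hhol.congr fun x hx ↦ (hs (A.toComplexPoints x) hx).symm
  -- the nowhere-vanishing holomorphic `1`-form `Res(Ω/F)`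
  set ω₀ : MForm 𝓘(ℝ, A.model) A.carrier ℂ 1 := residueForm (E := A.model) ψ F 1 with hω₀
  have hd : 1 + 2 ≤ 3 := le_rfl
  have hω : IsHolomorphicInCharts ω₀ :=
    isHolomorphicInCharts_residueForm ψ hF hψemb.continuous hψrange.le hjac hhol
      (P := 1) (MvPolynomial.isHomogeneous_one _ _) hd
  have h1 : Module.finrank ℂ A.model = 1 := A.isAnalytification.finrank_eq
  have hne : ∀ x, ω₀ x ≠ 0 := by
    intro x
    have hx := residueIdx_spec ψ x
    have h := residueForm_ne_zero ψ hF hψemb hψrange.le hjac hhol h1 hd hx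
    have hP1 : (MvPolynomial.X (residueIdx ψ x) ^ (3 - (1 + 2)) : MvPolynomial (Fin (1 + 2)) ℂ) = 1 := by
      norm_num
    rwa [hP1] at h
  exact ⟨finrank_hodgePQ_one_one_zero_le_one h1 hω hne,
    finrank_hodgePQ_one_zero_one_le_one h1 hω hne⟩

/-- **`b₁ ≤ 2` for a smooth plane cubic** `Y ⊂ ℙ²_ℂ`: by the Hodge decomposition of a Hodge
model `A` (`Hodge models exist, `nonempty_hodgeModel_holds`) every class of `H¹(Y(ℂ); ℂ)` is the sum
of a class of type `(1,0)` and one of type `(0,1)` (`HodgeModel.exists_sum_eq_of_hodgeDecomposition`),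
so the injective comparison `A^* : H¹(Y(ℂ); ℂ) → H¹(Y^an; ℂ)` lands in `H^{1,0}_A + H^{0,1}_A`, of
dimension `≤ 1 + 1`. (In print `b₁ = 2g = 2`.) [cite: Hartshorne1977, II Example 8.20.3]
[cite: FarkasKra1992, I.1.5 and II.5.3] -/
theorem finrank_complexBetti_one_le_two_of_isSmoothHypersurface_one_three
    (hY : Motives.IsSmoothHypersurface 1 3 Y) : Module.finrank ℂ (complexBetti Y 1) ≤ 2 := by
  classical
  obtain ⟨A⟩ := nonempty_hodgeModel_holds hY.1
  obtain ⟨h10, h01⟩ := finrank_hodgePQ_le_one_of_isSmoothHypersurface_one_three hY A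
  haveI : Module.Finite ℂ (singularCohomology ℂ ℂ A.carrier 1) := by
    haveI := finite_complexBetti hY.1 1
    exact Module.Finite.of_surjective (A.pullback 1).hom (A.pullback_surjective 1)
  -- the comparison lands in `H^{1,0} + H^{0,1}`
  have hle : LinearMap.range (A.pullback 1).hom ≤ A.hodgePQ 1 1 0 ⊔ A.hodgePQ 1 0 1 := by
    rintro _ ⟨c, rfl⟩
    obtain ⟨z, hz, hzt⟩ := A.exists_sum_eq_of_hodgeDecomposition 1 c
    rw [Finset.Nat.sum_antidiagonal_eq_sum_range_succ_mk, Finset.sum_range_succ,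
      Finset.sum_range_succ, Finset.sum_range_zero, zero_add] at hz
    rw [← hz, map_add]
    exact Submodule.add_mem _ (Submodule.mem_sup_right (hzt (0, 1) (by simp)))
      (Submodule.mem_sup_left (hzt (1, 0) (by simp)))
  -- dimensions: `A.hodgePQ` is the de Rham piece transported along the comparison isomorphism
  have hP : Module.finrank ℂ ↥(A.hodgePQ 1 1 0) ≤ 1 := by
    rw [HodgeModel.hodgePQ, LinearEquiv.finrank_map_eq]; exact h10
  have hQ : Module.finrank ℂ ↥(A.hodgePQ 1 0 1) ≤ 1 := by
    rw [HodgeModel.hodgePQ, LinearEquiv.finrank_map_eq]; exact h01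
  calc Module.finrank ℂ (complexBetti Y 1)
      = Module.finrank ℂ ↥(LinearMap.range (A.pullback 1).hom) :=
        (LinearMap.finrank_range_of_inj (A.pullback_injective 1)).symm
    _ ≤ Module.finrank ℂ ↥(A.hodgePQ 1 1 0 ⊔ A.hodgePQ 1 0 1) := Submodule.finrank_mono hle
    _ ≤ Module.finrank ℂ ↥(A.hodgePQ 1 1 0) + Module.finrank ℂ ↥(A.hodgePQ 1 0 1) :=
        Submodule.finrank_add_le_finrank_add_finrank _ _
    _ ≤ 1 + 1 := Nat.add_le_add hP hQ

end PlaneCubic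

/-! ### The Fermat cubic curve `C₃` and `H²(C₃ × C₃)` -/

section FermatCubic

/-- **`b₁(C₃) ≤ 2`** for the Fermat cubic curve `C₃ = V₊(x₀³ + x₁³ + x₂³) ⊂ ℙ²_ℂ` (a smooth plane
cubic, `isSmoothHypersurface_fermatHypersurface`). [cite: Hartshorne1977, II Example 8.20.3] -/
theorem finrank_complexBetti_one_fermatCubicCurve_le_two :
    Module.finrank ℂ (complexBetti (fermatHypersurface 1 3) 1) ≤ 2 :=
  finrank_complexBetti_one_le_two_of_isSmoothHypersurface_one_three
    (isSmoothHypersurface_fermatHypersurface le_rfl (by norm_num))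

/-- `b₀ = 1`, `b₁ ≤ 2`, `b₂ = 1` summed through Künneth: **`b₁(Spec ℂ × C₃) ≤ 2`** for the first
cartesian power `C₃.pow 1 = 𝟙 ⊗ C₃` (`b₁(𝟙 ⊗ C) = b₁(𝟙) b₀(C) + b₀(𝟙) b₁(C) = b₁(C)`).
[cite: HatcherAT2002, §3.2 Thm. 3.16] -/
theorem finrank_complexBetti_one_pow_one_fermatCubicCurve_le_two :
    Module.finrank ℂ (complexBetti ((fermatHypersurface 1 3).pow 1) 1) ≤ 2 := by
  have hC : IsSmoothProjective 1 (fermatHypersurface 1 3) :=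
    isSmoothProjective_fermatHypersurface le_rfl (by norm_num)
  have hU : IsSmoothProjective 0 (𝟙_ (SchemeOver ℂ)) := isSmoothProjective_unit_holds ℂ
  have h := finrank_complexBetti_tensor hU hC 1
  change Module.finrank ℂ (complexBetti (𝟙_ (SchemeOver ℂ) ⊗ fermatHypersurface 1 3) 1) ≤ 2
  rw [h, Finset.sum_range_succ, Finset.sum_range_succ, Finset.sum_range_zero, zero_add]
  haveI := subsingleton_complexBetti hU (k := 1) (by norm_num)
  rw [Module.finrank_zero_of_subsingleton (R := ℂ) (M := complexBetti (𝟙_ (SchemeOver ℂ)) (1 - 0)),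
    zero_mul, zero_add, Nat.sub_self, finrank_complexBetti_zero hU, one_mul]
  exact finrank_complexBetti_one_fermatCubicCurve_le_two

/-- **`dim_ℂ H²((C₃ × C₃)(ℂ); ℂ) ≤ 6`** on the carrier `(fermatHypersurface 1 3).pow 2 =
(Spec ℂ ⊗ C₃) ⊗ C₃` (Künneth: `b₂ = b₂ b₀ + b₁ b₁ + b₀ b₂ ≤ 1 + 2·2 + 1`; in print `= 6`, `C₃`
being an elliptic curve). This is hypothesis `h₆` of
`not_fermatHodgeClassesLiftToCurvePowers_of_finrank`. [cite: HatcherAT2002, §3.2 Thm. 3.16]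
[cite: Hartshorne1977, II Example 8.20.3] -/
theorem finrank_complexBetti_two_pow_two_fermatCubicCurve_le :
    Module.finrank ℂ (complexBetti ((fermatHypersurface 1 3).pow 2) (2 * 1)) ≤ 6 := by
  have hC : IsSmoothProjective 1 (fermatHypersurface 1 3) :=
    isSmoothProjective_fermatHypersurface le_rfl (by norm_num)
  have hY : IsSmoothProjective 1 ((fermatHypersurface 1 3).pow 1) := by
    simpa using hC.pow 1
  have h := finrank_complexBetti_tensor hY hC 2
  change Module.finrank ℂ (complexBetti ((fermatHypersurface 1 3).pow 1 ⊗ fermatHypersurface 1 3) 2) ≤ 6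
  rw [h, Finset.sum_range_succ, Finset.sum_range_succ, Finset.sum_range_succ, Finset.sum_range_zero,
    zero_add, Nat.sub_zero, finrank_complexBetti_two_of_curve hY, finrank_complexBetti_zero hC,
    show 2 - 1 = 1 from rfl, Nat.sub_self, finrank_complexBetti_zero hY,
    finrank_complexBetti_two_of_curve hC]
  have h₁ := finrank_complexBetti_one_pow_one_fermatCubicCurve_le_two
  have h₂ := finrank_complexBetti_one_fermatCubicCurve_le_two
  nlinarith

/-- `H²((C₃ × C₃)(ℂ); ℂ)` is finite-dimensional (a compact manifold), on the carrier
`(fermatHypersurface 1 3).pow 2` — the instance hypothesis of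
`not_fermatHodgeClassesLiftToCurvePowers_of_finrank`. [cite: HatcherAT2002, App. A Cor. A.8–A.9] -/
theorem finite_complexBetti_two_pow_two_fermatCubicCurve :
    Module.Finite ℂ (complexBetti ((fermatHypersurface 1 3).pow 2) (2 * 1)) :=
  finite_complexBetti ((isSmoothProjective_fermatHypersurface le_rfl (by norm_num)).pow 2) _

end FermatCubic

end Literature.AlgebraicGeometry.HodgeTheory

end
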